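import Literature.MathematicalPhysics.QuantumFieldTheory.QuasiLocalGaugePerturbationCells
import Literature.MathematicalPhysics.QuantumFieldTheory.QuasiLocalGaugePerturbationCovariance
import Literature.MathematicalPhysics.QuantumFieldTheory.BlockCellGeometry
import Literature.MathematicalPhysics.QuantumFieldTheory.YangMillsOS
import Literature.Probability.LatticeModels.CoarseCellMixingCounting
import HarnessLib

/-!
# Line `two-scale-lsi-handover` for the crux `RobustYangMillsHandover` (stmt-QuantumFields-8892) —
# the CLOSED stub `stub_clusterDeployment` (4′)

Checked skeleton: `Cruxes/RobustYangMillsHandover/Lines/two-scale-lsi-handover.lean` (lead reshape r1: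
stubs 3a `stub_cellDobrushinDecay`, 3b `stub_cubeInfluence`, 4′ `stub_clusterDeployment`). This module
proves the deployment `CellDobrushinDecay → CubeInfluence → CubeClustering` with the three statements
UNFOLDED (their texts are the skeleton's `def … : Prop`, verbatim), so that the skeleton closes the stub
by `exact stub_clusterDeployment`.

**Proof** (bookkeeping; constants existential). Fix `G, r, c ≥ 1, κ > 0`. Hypothesis 3b at weight rate
`t = κ/2 < κ` and target `ε₀ = 1/2` gives `βs, ηs > 0`; put `εs = min βs ηs`, `m = t/(4c) = κ/(8c)`.
For species `A, B` with sup bounds `‖A‖, ‖B‖` and time extents summing to `δ₀`, put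
`C_{AB} = 8‖A‖‖B‖ |supp B| (|supp A| |supp B|) e^{t(δ₀+2)} + 2‖A‖‖B‖ e^{mc}`. Given `|β| ≤ εs`, a block
torus `2S+1`, cube-diagonal `D`, `‖O‖_{c,κ} ≤ εs` with range control and `n ≤ S`:
* DLR — `μ_{β,D+O} = (D+O).perturbedMeasure r.ρ β` is a Gibbs (probability) measure for the kernels
  `(D+O).kernel r.ρ β` (`isSpecification_and_isGibbsMeasure_perturbedMeasure`; second countability and
  `T₂` of `G` come from the faithful continuous matrix representation `r.ρ`), and `covCorr` is the
  covariance of `f = A ∘ torusLift` and `g = B ∘ τ_n ∘ torusLift` under it (`covCorr_eq_integral`);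
* small tori `2S+1 < 2c`: `n ≤ S < c`, and `|cov(f,g)| ≤ 2‖A‖‖B‖ ≤ 2‖A‖‖B‖e^{mc} e^{-mn}`;
* otherwise frames of scale `2c`: `μ + 1 = (2S+1)/(2c)` cells per axis, `(μ+1)2c ≤ 2S+1 < (μ+2)2c`; 3b
  supplies influence coefficients `C ≥ 0` of the kernels through the cells of `prodFrame (2S+1) (2c) μ`
  with `Σ_y C y x e^{t cdist y x} ≤ 1/2`; with `Δf, Δg` the cells of the (shifted) supports
  (`dependsOn_comp_torusLift`, `dependsOn_comp_configShift_torusLift`) the weight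
  `θ x = Σ_{z ∈ Δg} e^{-t cdist x z}` satisfies `θ ≥ 0`, `θ ≥ 1` on `Δg` (`cdist_self`) and
  `θ y ≤ e^{t cdist y x} θ x` (`cdist_triangle`, `cdist_comm`), whence both received-sum conditions of
  3a with `c₀ = 1/2`; 3a gives `|cov| ≤ 8‖A‖‖B‖|Δg| Σ_{x∈Δf} θ x ≤ 8‖A‖‖B‖|Δg||Δf||Δg| e^{-tD}` with
  `D = n/(4c) - δ₀ - 1 ≤ cdist x z` (`le_cdist_cellOf_torusEdge_timeShift`, no wrap-around for `n ≤ S`),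
  and `e^{-tD} ≤ e^{t(δ₀+2)} e^{-(t/4c) n}`.

Sources: H.-O. Georgii, *Gibbs Measures and Phase Transitions* (2011), Rem. 1.24, §8.2 (Rem. 8.26);
H. Föllmer, Lecture Notes in Math. 1362 (1988), Ch. I Thm. (2.13); K. Osterwalder, E. Seiler,
Ann. Phys. 110 (1978) §2. The bookkeeping is folklore; the SU(3) template is the landed
`NestedDissectionSeaRobustYangMillsStubDeployment.level_bound`.
-/

noncomputable section

namespace Summit.QuantumFields.QCD.Cruxes.RobustYangMillsHandover.TwoScaleLsiHandover

open Literature.MathematicalPhysics.QuantumFieldTheory Literature.MathematicalPhysics.QuantumLattice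
open Literature.MathematicalPhysics.AQFT
open MeasureTheory Filter Topology
open Literature.Probability.LatticeModels (CoarseIdx cdist cdist_self cdist_triangle cdist_comm)

/-! ## Bookkeeping lemmas -/

/-- Rate bookkeeping on frames of scale `2c`: `e^{-t D} ≤ e^{t(δ₀+2)} e^{-(t/4c) n}` for the coarse
distance `D = n/(2·2c) - (δ₀+1)` (natural subtraction and division). [folklore] -/
private theorem exp_neg_mul_coarseDist_le {t : ℝ} {c n δ₀ : ℕ} (ht : 0 ≤ t) (hc : 0 < c) :
    Real.exp (-(t * ((n / (2 * (2 * c)) - (δ₀ + 1) : ℕ) : ℝ))) ≤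
      Real.exp (t * ((δ₀ + 2 : ℕ) : ℝ)) * Real.exp (-(t / (4 * c) * n)) := by
  -- adapted from `final_numeric` (NestedDissectionSeaRobustYangMillsStubDeployment)
  rw [← Real.exp_add]
  refine Real.exp_le_exp.2 ?_
  have hD1 : n / (2 * (2 * c)) ≤ (n / (2 * (2 * c)) - (δ₀ + 1)) + (δ₀ + 1) := le_tsub_add
  have hlt : n < n / (2 * (2 * c)) * (2 * (2 * c)) + 2 * (2 * c) := Nat.lt_div_mul_add (by omega)
  have h4c : (0 : ℝ) < 4 * c := by positivity
  have hlt' : (n : ℝ) < ((n / (2 * (2 * c)) : ℕ) + 1) * (4 * c) := by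
    have h' : (n : ℝ) < ((n / (2 * (2 * c)) : ℕ) : ℝ) * (2 * (2 * c) : ℕ) + (2 * (2 * c) : ℕ) := by
      exact_mod_cast hlt
    push_cast at h'
    nlinarith [h']
  have hq : (n : ℝ) / (4 * c) < ((n / (2 * (2 * c)) : ℕ) : ℝ) + 1 := by
    rw [div_lt_iff₀ h4c]; exact hlt'
  have hD1' : (((n / (2 * (2 * c))) : ℕ) : ℝ) ≤
      ((n / (2 * (2 * c)) - (δ₀ + 1) : ℕ) : ℝ) + (δ₀ + 1) := by exact_mod_cast hD1
  generalize ((n / (2 * (2 * c)) - (δ₀ + 1) : ℕ) : ℝ) = D at *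
  have h1 : (n : ℝ) / (4 * c) ≤ D + δ₀ + 2 := by linarith
  have h2 : t / (4 * c) * n = t * ((n : ℝ) / (4 * c)) := by ring
  rw [h2]
  have h3 := mul_le_mul_of_nonneg_left h1 ht
  push_cast
  nlinarith [h3]

/-- The distance-profile weight contracts along the coarse pseudometric:
`Σ_{z∈Δ} e^{-t cdist y z} ≤ e^{t cdist y x} Σ_{z∈Δ} e^{-t cdist x z}` (triangle inequality and symmetry
of `cdist`). [folklore] -/
private theorem sum_exp_neg_cdist_le_exp_mul {d : ℕ} {μc : Fin d → ℕ} (Δ : Finset (CoarseIdx μc))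
    {t : ℝ} (ht : 0 ≤ t) (x y : CoarseIdx μc) :
    ∑ z ∈ Δ, Real.exp (-(t * cdist y z)) ≤
      Real.exp (t * cdist y x) * ∑ z ∈ Δ, Real.exp (-(t * cdist x z)) := by
  rw [Finset.mul_sum]
  refine Finset.sum_le_sum fun z _ => ?_
  rw [← Real.exp_add]
  refine Real.exp_le_exp.2 ?_
  have h := cdist_triangle x y z
  rw [cdist_comm x y] at h
  have h' : (cdist x z : ℝ) ≤ cdist y x + cdist y z := by exact_mod_cast h
  nlinarith [mul_le_mul_of_nonneg_left h' ht]

/-- The trivial covariance bound under a probability measure: `|ν(fg) - ν(f)ν(g)| ≤ 2 B_f B_g` for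
`|f| ≤ B_f`, `|g| ≤ B_g`. [folklore] -/
private theorem abs_cov_le_two_mul {α : Type*} [MeasurableSpace α] (ν : Measure α)
    [IsProbabilityMeasure ν] {f g : α → ℝ} {Bf Bg : ℝ} (hf : ∀ σ, |f σ| ≤ Bf)
    (hg : ∀ σ, |g σ| ≤ Bg) :
    |∫ σ, f σ * g σ ∂ν - (∫ σ, f σ ∂ν) * ∫ σ, g σ ∂ν| ≤ 2 * Bf * Bg := by
  have hBf : 0 ≤ Bf := (abs_nonneg _).trans (hf (Classical.choice (by
    by_contra h; rw [not_nonempty_iff] at h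
    exact (IsProbabilityMeasure.ne_zero ν) (Measure.eq_zero_of_isEmpty ν))))
  have bound : ∀ (h : α → ℝ) (C : ℝ), (∀ σ, |h σ| ≤ C) → |∫ σ, h σ ∂ν| ≤ C := fun h C hh => by
    have key := norm_integral_le_of_norm_le_const (μ := ν) (f := h) (C := C)
      (Filter.Eventually.of_forall fun σ => by rw [Real.norm_eq_abs]; exact hh σ)
    simpa only [Real.norm_eq_abs, probReal_univ, mul_one] using key
  have h1 : |∫ σ, f σ * g σ ∂ν| ≤ Bf * Bg := bound _ _ fun σ => by
    rw [abs_mul]; exact mul_le_mul (hf σ) (hg σ) (abs_nonneg _) hBf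
  have h2 : |(∫ σ, f σ ∂ν) * ∫ σ, g σ ∂ν| ≤ Bf * Bg := by
    rw [abs_mul]; exact mul_le_mul (bound _ _ hf) (bound _ _ hg) (abs_nonneg _) hBf
  calc |∫ σ, f σ * g σ ∂ν - (∫ σ, f σ ∂ν) * ∫ σ, g σ ∂ν|
      ≤ |∫ σ, f σ * g σ ∂ν| + |(∫ σ, f σ ∂ν) * ∫ σ, g σ ∂ν| := abs_sub _ _
    _ ≤ Bf * Bg + Bf * Bg := add_le_add h1 h2
    _ = 2 * Bf * Bg := by ring

/-- The distance-profile weight `θ x = Σ_{z∈Δg} e^{-t cdist x z}` of a cell set `Δg` and influence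
coefficients `C ≥ 0` with exponentially weighted received sums `≤ c₀`: `θ ≥ 0`, `θ ≥ 1` on `Δg`, and the
plain and the `θ`-weighted received sums are `≤ c₀` resp. `≤ c₀ θ x` (the two row conditions of the
weighted Dobrushin comparison). [folklore] -/
private theorem weight_rows {d : ℕ} {μc : Fin d → ℕ} (Δg : Finset (CoarseIdx μc)) {t c₀ : ℝ}
    (ht : 0 ≤ t) (C : CoarseIdx μc → CoarseIdx μc → ℝ) (hC0 : ∀ y x, 0 ≤ C y x)
    (hrow : ∀ x, ∑ y, C y x * Real.exp (t * cdist y x) ≤ c₀) :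
    (∀ x, 0 ≤ ∑ z ∈ Δg, Real.exp (-(t * cdist x z))) ∧
      (∀ x ∈ Δg, 1 ≤ ∑ z ∈ Δg, Real.exp (-(t * cdist x z))) ∧
      (∀ x, x ∉ Δg → ∑ y, C y x ≤ c₀) ∧
      (∀ x, x ∉ Δg → ∑ y, C y x * ∑ z ∈ Δg, Real.exp (-(t * cdist y z)) ≤
        c₀ * ∑ z ∈ Δg, Real.exp (-(t * cdist x z))) := by
  have hθ0 : ∀ x, 0 ≤ ∑ z ∈ Δg, Real.exp (-(t * cdist x z)) := fun x =>
    Finset.sum_nonneg fun z _ => (Real.exp_pos _).le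
  refine ⟨hθ0, fun x hx => ?_, fun x _ => ?_, fun x _ => ?_⟩
  · calc (1 : ℝ) = Real.exp (-(t * cdist x x)) := by simp
      _ ≤ ∑ z ∈ Δg, Real.exp (-(t * cdist x z)) :=
        Finset.single_le_sum (f := fun z => Real.exp (-(t * cdist x z)))
          (fun z _ => (Real.exp_pos _).le) hx
  · exact (Finset.sum_le_sum fun y _ => le_mul_of_one_le_right (hC0 y x)
      (Real.one_le_exp (by positivity))).trans (hrow x)
  · calc ∑ y, C y x * ∑ z ∈ Δg, Real.exp (-(t * cdist y z))
        ≤ ∑ y, C y x * (Real.exp (t * cdist y x) * ∑ z ∈ Δg, Real.exp (-(t * cdist x z))) :=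
          Finset.sum_le_sum fun y _ => mul_le_mul_of_nonneg_left
            (sum_exp_neg_cdist_le_exp_mul Δg ht x y) (hC0 y x)
      _ = (∑ y, C y x * Real.exp (t * cdist y x)) * ∑ z ∈ Δg, Real.exp (-(t * cdist x z)) := by
          rw [Finset.sum_mul]; exact Finset.sum_congr rfl fun y _ => (mul_assoc _ _ _).symm
      _ ≤ c₀ * ∑ z ∈ Δg, Real.exp (-(t * cdist x z)) :=
          mul_le_mul_of_nonneg_right (hrow x) (hθ0 x)

/-- **Tail of the level bound** (geometry and rates): the output
`8 B_f B_g |Δg| Σ_{x∈Δf} θ x` of the weighted comparison for two species read through `torusLift` / `τ_n`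
on the torus `2S+1` with frames of scale `2c` (`μ + 1` cells per axis, `n ≤ S`) is at most
`8 B_f B_g |supp B| (|supp A| |supp B|) e^{t(δ₀+2)} e^{-(t/4c) n}`, `t = κ/2`: the cells of the supports
number `≤ |supp|` and are at coarse distance `≥ n/(4c) - δ₀ - 1` (`le_cdist_cellOf_torusEdge_timeShift`).
[folklore] -/
private theorem tail_bound {G : Type} [Group G] [MeasurableSpace G] {S c μ n : ℕ} {κ Ca Cb X : ℝ}
    (hc : 0 < c) (hκ : 0 < κ) (hCa0 : 0 ≤ Ca) (hCb0 : 0 ≤ Cb)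
    (h2' : 2 * S + 1 < μ * (2 * c) + 2 * (2 * c)) (A B : YMSpecies G) (hn : n ≤ S)
    (hX : X ≤ 8 * Ca * Cb *
      ((B.supp.image fun e => cellOf (prodFrame (2 * S + 1) (2 * c) μ)
        (torusEdge (2 * S + 1) (e.1 - -Pi.single (0 : Fin 4) (n : ℤ), e.2))).card : ℝ) *
      ∑ x ∈ A.supp.image (fun e => cellOf (prodFrame (2 * S + 1) (2 * c) μ) (torusEdge (2 * S + 1) e)),
        ∑ z ∈ B.supp.image (fun e => cellOf (prodFrame (2 * S + 1) (2 * c) μ)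
          (torusEdge (2 * S + 1) (e.1 - -Pi.single (0 : Fin 4) (n : ℤ), e.2))),
          Real.exp (-(κ / 2 * cdist x z))) :
    X ≤ 8 * Ca * Cb * B.supp.card * (A.supp.card * B.supp.card) *
      Real.exp (κ / 2 * (((A.supp.sup fun e => (e.1 0).natAbs) +
        (B.supp.sup fun e => (e.1 0).natAbs) + 2 : ℕ) : ℝ)) * Real.exp (-(κ / 2 / (4 * c) * n)) := by
  -- adapted from `level_bound` (NestedDissectionSeaRobustYangMillsStubDeployment)
  refine hX.trans ?_
  set Δf := A.supp.image (fun e => cellOf (prodFrame (2 * S + 1) (2 * c) μ)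
    (torusEdge (2 * S + 1) e)) with hΔf
  set Δg := B.supp.image (fun e => cellOf (prodFrame (2 * S + 1) (2 * c) μ)
    (torusEdge (2 * S + 1) (e.1 - -Pi.single (0 : Fin 4) (n : ℤ), e.2))) with hΔg
  have ht0 : (0 : ℝ) ≤ κ / 2 := by positivity
  have hb'pos : 0 < 2 * c := by omega
  have hD := le_cdist_cellOf_torusEdge_timeShift hb'pos h2' A.supp B.supp hn
  have hnum := exp_neg_mul_coarseDist_le (t := κ / 2) (n := n)
    (δ₀ := (A.supp.sup fun e => (e.1 0).natAbs) + (B.supp.sup fun e => (e.1 0).natAbs)) ht0 hc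
  generalize n / (2 * (2 * c)) - ((A.supp.sup fun e => (e.1 0).natAbs) +
    (B.supp.sup fun e => (e.1 0).natAbs) + 1) = Dn at hD hnum
  have hΔf : (Δf.card : ℝ) ≤ A.supp.card := by exact_mod_cast Finset.card_image_le
  have hΔg : (Δg.card : ℝ) ≤ B.supp.card := by exact_mod_cast Finset.card_image_le
  have hsum : ∑ x ∈ Δf, ∑ z ∈ Δg, Real.exp (-(κ / 2 * cdist x z)) ≤
      Δf.card * (Δg.card * Real.exp (-(κ / 2 * (Dn : ℝ)))) := by
    calc ∑ x ∈ Δf, ∑ z ∈ Δg, Real.exp (-(κ / 2 * cdist x z))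
        ≤ ∑ x ∈ Δf, (Δg.card * Real.exp (-(κ / 2 * (Dn : ℝ))) : ℝ) :=
          Finset.sum_le_sum fun x hx => by
            calc ∑ z ∈ Δg, Real.exp (-(κ / 2 * cdist x z))
                ≤ ∑ z ∈ Δg, Real.exp (-(κ / 2 * (Dn : ℝ))) := Finset.sum_le_sum fun z hz =>
                  Real.exp_le_exp.2 (neg_le_neg (mul_le_mul_of_nonneg_left
                    (by exact_mod_cast hD x hx z hz) ht0))
              _ = Δg.card * Real.exp (-(κ / 2 * (Dn : ℝ))) := by
                  rw [Finset.sum_const, nsmul_eq_mul]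
      _ = Δf.card * (Δg.card * Real.exp (-(κ / 2 * (Dn : ℝ)))) := by
          rw [Finset.sum_const, nsmul_eq_mul]
  have hK : 0 ≤ 8 * Ca * Cb := by positivity
  have hin : ∑ x ∈ Δf, ∑ z ∈ Δg, Real.exp (-(κ / 2 * cdist x z)) ≤ A.supp.card * (B.supp.card *
      (Real.exp (κ / 2 * (((A.supp.sup fun e => (e.1 0).natAbs) +
        (B.supp.sup fun e => (e.1 0).natAbs) + 2 : ℕ) : ℝ)) *
        Real.exp (-(κ / 2 / (4 * c) * n)))) :=
    hsum.trans (mul_le_mul hΔf (mul_le_mul hΔg hnum (Real.exp_pos _).le (Nat.cast_nonneg _))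
      (mul_nonneg (Nat.cast_nonneg _) (Real.exp_pos _).le) (Nat.cast_nonneg _))
  calc 8 * Ca * Cb * (Δg.card : ℝ) * ∑ x ∈ Δf, ∑ z ∈ Δg, Real.exp (-(κ / 2 * cdist x z))
      ≤ 8 * Ca * Cb * (B.supp.card : ℝ) * (A.supp.card * (B.supp.card *
        (Real.exp (κ / 2 * (((A.supp.sup fun e => (e.1 0).natAbs) +
          (B.supp.sup fun e => (e.1 0).natAbs) + 2 : ℕ) : ℝ)) *
          Real.exp (-(κ / 2 / (4 * c) * n))))) :=
        mul_le_mul (mul_le_mul_of_nonneg_left hΔg hK) hin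
          (Finset.sum_nonneg fun x _ => Finset.sum_nonneg fun z _ => (Real.exp_pos _).le)
          (mul_nonneg hK (Nat.cast_nonneg _))
    _ = _ := by simp only [mul_assoc]

/-! ## The deployment -/

/-- **`stub_clusterDeployment` (4′, CLOSED)** — `CellDobrushinDecay → CubeInfluence → CubeClustering`
with the three statements of the skeleton unfolded verbatim: Dobrushin's weighted comparison estimate
for a general specification read through cells (3a) and the one-boundary-cell influence coefficients of
the kernels of `μ_{β,D+O}` through cells of scale `2c` (3b) give uniform exponential clustering of the
genuine covariances `covCorr` of species observables under `μ_{β,D+O}` on every block torus `2S+1`,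
with smallness `εs = min βs ηs` (3b at `t = κ/2`, `ε₀ = 1/2`), rate `m = κ/(8c)` and per-pair constant
`8‖A‖‖B‖|supp B|²|supp A| e^{κ(δ₀+2)/2} + 2‖A‖‖B‖e^{mc}`; frames `prodFrame (2S+1) (2c) μ`,
`μ + 1 = (2S+1)/(2c)`, tori smaller than `2c` by the trivial bound; weight `θ x = Σ_{z∈Δ_B} e^{-t cdist x z}`,
`c₀ = 1/2`. [cite: Georgii2011, Remark 1.24 and §8.2 Remark 8.26] [cite: Follmer1988, Ch. I Theorem (2.13)] -/
theorem stub_clusterDeployment :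
    (∀ (ι V S : Type) [Fintype ι] [DecidableEq ι] [Fintype V] [DecidableEq V] [MeasurableSpace S]
      (cell : V → ι) (γ : Literature.Probability.LatticeModels.Specification V S),
      Literature.Probability.LatticeModels.IsSpecification γ →
      ∀ (C : ι → ι → ℝ), (∀ y x, 0 ≤ C y x) →
      (∀ (x y : ι), y ≠ x → ∀ (ω η : V → S), (∀ v, cell v ≠ y → ω v = η v) →
        ∀ (f : (V → S) → ℝ) (δ : ℝ), Measurable f → (∃ B : ℝ, ∀ σ, |f σ| ≤ B) →
          DependsOn f {v | cell v = x} → 0 ≤ δ →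
          (∀ σ τ : V → S, (∀ v, cell v ≠ x → σ v = τ v) → |f σ - f τ| ≤ δ) →
            |(∫ σ, f σ ∂(γ (Finset.univ.filter fun v => cell v = x) ω)) -
                ∫ σ, f σ ∂(γ (Finset.univ.filter fun v => cell v = x) η)| ≤ C y x * δ) →
      ∀ (ν : MeasureTheory.Measure (V → S)), Literature.Probability.LatticeModels.IsGibbsMeasure γ ν →
      ∀ (f g : (V → S) → ℝ) (Δf Δg : Finset ι) (Bf Bg : ℝ),
        Measurable f → Measurable g → (∀ σ, |f σ| ≤ Bf) → (∀ σ, |g σ| ≤ Bg) →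
        DependsOn f {v | cell v ∈ Δf} → DependsOn g {v | cell v ∈ Δg} →
      ∀ (θ : ι → ℝ) (c₀ : ℝ), (∀ x, 0 ≤ θ x) → (∀ x ∈ Δg, 1 ≤ θ x) → 0 ≤ c₀ → c₀ < 1 →
        (∀ x, x ∉ Δg → ∑ y, C y x ≤ c₀) → (∀ x, x ∉ Δg → ∑ y, C y x * θ y ≤ c₀ * θ x) →
          |∫ σ, f σ * g σ ∂ν - (∫ σ, f σ ∂ν) * ∫ σ, g σ ∂ν| ≤ 8 * Bf * Bg * Δg.card * ∑ x ∈ Δf, θ x) →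
    (∀ (G : Type) [Group G] [TopologicalSpace G] [IsTopologicalGroup G] [CompactSpace G]
        [MeasurableSpace G] [BorelSpace G], ∀ (r : LatticeRep G) (c : ℕ) (κ t ε₀ : ℝ),
      0 < c → 0 < κ → 0 ≤ t → t < κ → 0 < ε₀ →
      ∃ βs : ℝ, 0 < βs ∧ ∃ ηs : ℝ, 0 < ηs ∧ ∀ (β η : ℝ), |β| ≤ βs → 0 ≤ η → η ≤ ηs →
        ∀ (Lt μ : ℕ) [NeZero Lt], (μ + 1) * (2 * c) ≤ Lt → Lt < (μ + 2) * (2 * c) →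
        ∀ (D O : QuasiLocalGaugePerturbation 4 Lt G c),
          (∀ X : Finset (Site 4 Lt), X.card ≠ 1 → ∀ V : GaugeConfig 4 Lt G, D.act X V = 0) →
          O.NormLE κ η →
          (∀ X : Finset (Site 4 Lt), X ∈ polymers c → (∃ U : GaugeConfig 4 Lt G, O.act X U ≠ 0) →
            ∀ y ∈ X, ∀ y' ∈ X, ∀ i : Fin 4, (y i - y' i).val ≤ c * X.card ∨ (y' i - y i).val ≤ c * X.card) →
          ∃ C : Literature.Probability.LatticeModels.CoarseIdx (fun _ : Fin 4 => μ) →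
              Literature.Probability.LatticeModels.CoarseIdx (fun _ : Fin 4 => μ) → ℝ,
            (∀ y x, 0 ≤ C y x) ∧
            (∀ x y, y ≠ x → ∀ (ω ζ : GaugeConfig 4 Lt G),
              (∀ e, cellOf (prodFrame Lt (2 * c) μ) e ≠ y → ω e = ζ e) →
              ∀ (f : GaugeConfig 4 Lt G → ℝ) (δ : ℝ), Measurable f → (∃ B : ℝ, ∀ U, |f U| ≤ B) →
                DependsOn f {e | cellOf (prodFrame Lt (2 * c) μ) e = x} → 0 ≤ δ →
                (∀ U U' : GaugeConfig 4 Lt G,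
                  (∀ e, cellOf (prodFrame Lt (2 * c) μ) e ≠ x → U e = U' e) → |f U - f U'| ≤ δ) →
                |(∫ U, f U ∂((D + O).kernel r.ρ β
                      (Finset.univ.filter fun e => cellOf (prodFrame Lt (2 * c) μ) e = x) ω)) -
                    ∫ U, f U ∂((D + O).kernel r.ρ β
                      (Finset.univ.filter fun e => cellOf (prodFrame Lt (2 * c) μ) e = x) ζ)| ≤
                  C y x * δ) ∧
            ∀ x, ∑ y, C y x * Real.exp (t * Literature.Probability.LatticeModels.cdist y x) ≤ ε₀) →
    (∀ (G : Type) [Group G] [TopologicalSpace G] [IsTopologicalGroup G] [CompactSpace G]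
        [MeasurableSpace G] [BorelSpace G], ∀ (r : LatticeRep G) (c : ℕ) (κ : ℝ), 0 < c → 0 < κ →
      ∃ εs : ℝ, 0 < εs ∧ ∃ m : ℝ, 0 < m ∧ ∀ A B : YMSpecies G, ∃ Cc : ℝ, ∀ β : ℝ, |β| ≤ εs →
        ∀ (S : ℕ) (D O : QuasiLocalGaugePerturbation 4 (2 * S + 1) G c),
          (∀ X : Finset (Site 4 (2 * S + 1)), X.card ≠ 1 → ∀ V : GaugeConfig 4 (2 * S + 1) G, D.act X V = 0) →
          O.NormLE κ εs →
          (∀ X : Finset (Site 4 (2 * S + 1)), X ∈ polymers c →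
            (∃ U : GaugeConfig 4 (2 * S + 1) G, O.act X U ≠ 0) →
            ∀ y ∈ X, ∀ y' ∈ X, ∀ i : Fin 4, (y i - y' i).val ≤ c * X.card ∨ (y' i - y i).val ≤ c * X.card) →
          ∀ n : ℕ, n ≤ S → |(D + O).covCorr r.ρ β A.F B.F n| ≤ Cc * Real.exp (-(m * n))) := by
  intro hDob hInf G _ _ _ _ _ _ r c κ hc hκ
  -- constants from 3b at weight rate `t = κ/2` and target `ε₀ = 1/2`
  have ht0 : (0 : ℝ) ≤ κ / 2 := by positivity
  obtain ⟨βs, hβs, ηs, hηs, hcoef⟩ :=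
    hInf G r c κ (κ / 2) (1 / 2) hc hκ ht0 (half_lt_self hκ) one_half_pos
  refine ⟨min βs ηs, lt_min hβs hηs, κ / 2 / (4 * c), by positivity, fun A B => ?_⟩
  obtain ⟨Ca, hCa⟩ := A.bounded
  obtain ⟨Cb, hCb⟩ := B.bounded
  have hCa0 : 0 ≤ Ca := (abs_nonneg _).trans (hCa fun _ => 1)
  have hCb0 : 0 ≤ Cb := (abs_nonneg _).trans (hCb fun _ => 1)
  refine ⟨8 * Ca * Cb * B.supp.card * (A.supp.card * B.supp.card) *
      Real.exp (κ / 2 * (((A.supp.sup fun e => (e.1 0).natAbs) +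
        (B.supp.sup fun e => (e.1 0).natAbs) + 2 : ℕ) : ℝ)) +
      2 * Ca * Cb * Real.exp (κ / 2 / (4 * c) * c), ?_⟩
  intro β hβ S D O hD hO hRC n hn
  -- second countability, `T₂` (hence measurable singletons) of `G` from the faithful representation
  haveI : SecondCountableTopology G :=
    (r.continuous.isClosedEmbedding r.injective).isEmbedding.secondCountableTopology
  haveI : T2Space G := (r.continuous.isClosedEmbedding r.injective).isEmbedding.t2Space
  -- DLR for `μ_{β, D+O}` (Georgii Rem. 1.24): kernels `(D+O).kernel r.ρ β`, Gibbs measure `perturbedMeasure`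
  have hDLR := QuasiLocalGaugePerturbation.isSpecification_and_isGibbsMeasure_perturbedMeasure
    r.ρ r.continuous β (D + O)
  have hsp : Literature.Probability.LatticeModels.IsSpecification ((D + O).kernel r.ρ β) := hDLR.1
  have hgibbs : Literature.Probability.LatticeModels.IsGibbsMeasure ((D + O).kernel r.ρ β)
      ((D + O).perturbedMeasure r.ρ β) := hDLR.2
  haveI : IsProbabilityMeasure ((D + O).perturbedMeasure r.ρ β) := hgibbs.1
  have hK8 : 0 ≤ 8 * Ca * Cb := by positivity
  have hK2 : 0 ≤ 2 * Ca * Cb := by positivity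
  have hexp1 : 0 ≤ 8 * Ca * Cb * B.supp.card * (A.supp.card * B.supp.card) *
      Real.exp (κ / 2 * (((A.supp.sup fun e => (e.1 0).natAbs) +
        (B.supp.sup fun e => (e.1 0).natAbs) + 2 : ℕ) : ℝ)) :=
    mul_nonneg (mul_nonneg (mul_nonneg hK8 (Nat.cast_nonneg _))
      (mul_nonneg (Nat.cast_nonneg _) (Nat.cast_nonneg _))) (Real.exp_pos _).le
  have hexp2 : 0 ≤ 2 * Ca * Cb * Real.exp (κ / 2 / (4 * c) * c) := mul_nonneg hK2 (Real.exp_pos _).le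
  rw [QuasiLocalGaugePerturbation.covCorr_eq_integral]
  by_cases h2c : 2 * c ≤ 2 * S + 1
  · -- frames of scale `2c`: `μ + 1 = (2S+1)/(2c)` cells per axis
    obtain ⟨μ, hμ⟩ : ∃ μ : ℕ, μ = (2 * S + 1) / (2 * c) - 1 := ⟨_, rfl⟩
    have hb'pos : 0 < 2 * c := by omega
    have hM1 : 1 ≤ (2 * S + 1) / (2 * c) :=
      (Nat.le_div_iff_mul_le hb'pos).2 (by rw [one_mul]; exact h2c)
    have hμ1 : μ + 1 = (2 * S + 1) / (2 * c) := by rw [hμ]; exact Nat.sub_add_cancel hM1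
    have h1 : (μ + 1) * (2 * c) ≤ 2 * S + 1 := by rw [hμ1]; exact Nat.div_mul_le_self _ _
    have hlt : 2 * S + 1 < (2 * S + 1) / (2 * c) * (2 * c) + 2 * c := Nat.lt_div_mul_add hb'pos
    have h2 : 2 * S + 1 < (μ + 2) * (2 * c) := by
      rw [← hμ1] at hlt
      calc 2 * S + 1 < (μ + 1) * (2 * c) + 2 * c := hlt
        _ = (μ + 2) * (2 * c) := by ring
    have h2' : 2 * S + 1 < μ * (2 * c) + 2 * (2 * c) := by
      calc 2 * S + 1 < (μ + 2) * (2 * c) := h2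
        _ = μ * (2 * c) + 2 * (2 * c) := by ring
    -- 3b: influence coefficients of the kernels through the cells of `prodFrame (2S+1) (2c) μ`
    obtain ⟨C, hC0, hCon, hrow⟩ := hcoef β (min βs ηs) (hβ.trans (min_le_left _ _))
      (le_min hβs.le hηs.le) (min_le_right _ _) (2 * S + 1) μ h1 h2 D O hD hO hRC
    -- the two observables
    have hf : Measurable fun U : GaugeConfig 4 (2 * S + 1) G => A.F (torusLift (2 * S + 1) U) :=
      A.measurable.comp (measurable_torusLift _)
    have hg : Measurable fun U : GaugeConfig 4 (2 * S + 1) G =>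
        B.F (configShift (-Pi.single (0 : Fin 4) (n : ℤ)) (torusLift (2 * S + 1) U)) :=
      B.measurable.comp ((configShift _).measurable.comp (measurable_torusLift _))
    -- the cells of the shifted support of `B`, the weight `θ x = Σ_{z∈Δg} e^{-t cdist x z}`, rows
    set Δg : Finset (CoarseIdx fun _ : Fin 4 => μ) := B.supp.image fun e =>
      cellOf (prodFrame (2 * S + 1) (2 * c) μ)
        (torusEdge (2 * S + 1) (e.1 - -Pi.single (0 : Fin 4) (n : ℤ), e.2)) with hΔg
    obtain ⟨hθ0, hθ1, hrow1, hrow2⟩ := weight_rows Δg ht0 C hC0 hrow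
    -- 3a: the weighted comparison estimate, then geometry and rates
    have hmain := hDob (CoarseIdx fun _ : Fin 4 => μ) (Edge 4 (2 * S + 1)) G
      (cellOf (prodFrame (2 * S + 1) (2 * c) μ)) ((D + O).kernel r.ρ β) hsp C hC0 hCon
      ((D + O).perturbedMeasure r.ρ β) hgibbs _ _ _ Δg Ca Cb hf hg (fun U => hCa _)
      (fun U => hCb _) (dependsOn_comp_torusLift A.isCylinder _)
      (dependsOn_comp_configShift_torusLift B.isCylinder _ _)
      (fun x => ∑ z ∈ Δg, Real.exp (-(κ / 2 * cdist x z))) (1 / 2) hθ0 hθ1 (by norm_num)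
      (by norm_num) hrow1 hrow2
    exact (tail_bound hc hκ hCa0 hCb0 h2' A B hn hmain).trans (by
      rw [add_mul]; exact le_add_of_nonneg_right (mul_nonneg hexp2 (Real.exp_pos _).le))
  · -- tori smaller than one frame: `n ≤ S < c`, trivial bound
    push Not at h2c
    have hnc : n < c := by omega
    have htriv := abs_cov_le_two_mul ((D + O).perturbedMeasure r.ρ β)
      (f := fun U => A.F (torusLift (2 * S + 1) U))
      (g := fun U => B.F (configShift (-Pi.single (0 : Fin 4) (n : ℤ)) (torusLift (2 * S + 1) U)))
      (fun U => hCa _) (fun U => hCb _)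
    refine htriv.trans ?_
    have hm0 : 0 ≤ κ / 2 / (4 * c) := by positivity
    have hexp : (1 : ℝ) ≤ Real.exp (κ / 2 / (4 * c) * c) * Real.exp (-(κ / 2 / (4 * c) * n)) := by
      rw [← Real.exp_add]
      refine Real.one_le_exp ?_
      have hnc' : (n : ℝ) ≤ c := by exact_mod_cast hnc.le
      nlinarith [mul_le_mul_of_nonneg_left hnc' hm0]
    calc 2 * Ca * Cb ≤ 2 * Ca * Cb *
          (Real.exp (κ / 2 / (4 * c) * c) * Real.exp (-(κ / 2 / (4 * c) * n))) :=
          le_mul_of_one_le_right hK2 hexp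
      _ = 2 * Ca * Cb * Real.exp (κ / 2 / (4 * c) * c) * Real.exp (-(κ / 2 / (4 * c) * n)) :=
          (mul_assoc _ _ _).symm
      _ ≤ _ := by
          rw [add_mul]
          exact le_add_of_nonneg_left (mul_nonneg hexp1 (Real.exp_pos _).le)

end Summit.QuantumFields.QCD.Cruxes.RobustYangMillsHandover.TwoScaleLsiHandover

end
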